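import Summits.CriticalPhenomena.CardyFormulaZ2.Theorems.ModulusResponseSmirnovCellAnchorApprox
import Literature.Probability.Percolation.CardyFormulaConformalInvariance
import Literature.Probability.Percolation.SmirnovTheoremProofs

/-!
# The scaling limit of the cell crossing probability from the sandwich (support item `SmirnovCellAnchor`)

Helper file for `Summit.CriticalPhenomena.CardyFormulaZ2.Theses.ModulusResponse.SmirnovCellAnchor`
(stmt-CriticalPhenomena-6471). For a conformal rectangle `R` with an anticlockwise Carleson datum
`(a, b, c, d, ψ)` and a quantity `cell δ` sandwiched by the open crossing probabilities of the
marked discrete domains of Bollobás–Riordan's Lemma 14 (`hsandL`, `hsandU` of `…Approx`), we run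
the continuum half of the tree's proof of Smirnov's theorem (Bollobás–Riordan, *Percolation*
(2006), Ch. 7, pp. 196–203): separating data of the discrete approximations
(`isSeparatingData_of_discreteApprox` with Lemma 13, the estimates of pp. 198 and 200–201 and (40),
all discharged in the tree), their McShane interpolants (`IsSeparatingData.isSmirnovFamily`) and the
Arzelà–Ascoli argument (`IsSmirnovFamily.tendsto_apply_one`, with (M) and Claim 24 discharged), to
obtain `cell δ → |d - c| / |a - c|` (`tendsto_cell_of_sandwich`). The only change with respect to
the tree (`smirnov_separatingData_of_discreteApprox`, `smirnov_exists_separatingFamilies_of_separatingData`,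
`smirnov_tendsto_triDomainCrossingProb_of_limitArgument`) is that the middle term of the sandwich is
`cell δ` instead of `triDomainCrossingProb R δ`.
-/

noncomputable section

open Set Metric Filter Topology MeasureTheory Literature.Probability.LatticeModels Literature.Probability.RandomPlanarGeometry
  Literature.Probability.Percolation

namespace Summit.CriticalPhenomena.CardyFormulaZ2.Theorems.SmirnovCellAnchor

/-- **The limit of the sandwiched quantity is Carleson's ratio** (see the module docstring).
[cite: BollobasRiordan2006, Ch. 7 proof of Thm. 2 pp. 202–203] -/
theorem tendsto_cell_of_sandwich (R : ConformalRectangle) (a b c d : ℂ)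
    (ψ : ConformalEquiv R.carrier (openTriangle a b c)) (habc : IsEquilateral a b c)
    (hd : d ∈ openSegment ℝ c a) (hψ : IsCarlesonMap R a b c d ψ) (hacw : triangleTurn a b c = triOmega)
    (cell : ℝ → ℝ)
    (hsandL : ∀ ρ > (0 : ℝ), ∃ δ₀ > 0, ∃ t₀ > 0, ∀ δ t : ℝ, 0 < δ → δ < δ₀ → 0 ≤ t → t ≤ t₀ → ∀ {r₁ r₂ : ℝ}, ρ ≤ r₁ →
      ∀ G : TriMarkedDomain 4,
        (∀ x ∈ G.verts, triMeshPoint δ x ∉ R.carrier →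
          infDist (triMeshPoint δ x) (R.arc 0) ≤ t ∨ infDist (triMeshPoint δ x) (R.arc 2) ≤ t) →
        (∀ x ∈ G.verts, triMeshPoint δ x ∈ R.carrier → (∀ i, ρ ≤ dist (triMeshPoint δ x) (R.pt i)) →
          8 * δ < infDist (triMeshPoint δ x) (R.arc 1) ∧ 8 * δ < infDist (triMeshPoint δ x) (R.arc 3)) →
        (∀ u ∈ G.arc 0, (∀ i, ρ ≤ dist (triMeshPoint δ u) (R.pt i)) →
          triMeshPoint δ u ∉ R.carrier ∧ infDist (triMeshPoint δ u) (R.arc 0) ≤ t) →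
        (∀ v ∈ G.arc 2, (∀ i, ρ ≤ dist (triMeshPoint δ v) (R.pt i)) →
          triMeshPoint δ v ∉ R.carrier ∧ infDist (triMeshPoint δ v) (R.arc 2) ≤ t) →
        (∀ u ∈ G.arc 0, r₂ < dist (triMeshPoint δ u) (R.pt 2) ∧ r₂ < dist (triMeshPoint δ u) (R.pt 3)) →
        (∀ v ∈ G.arc 2, r₂ < dist (triMeshPoint δ v) (R.pt 0) ∧ r₂ < dist (triMeshPoint δ v) (R.pt 1)) →
        G.openCrossingProb 0 2 ≤ cell δ +
          ∑ i : Fin 4, (triSitePercolation half).real (triAnnulusCrossing true δ (R.pt i) r₁ r₂))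
    (hsandU : ∀ ρ > (0 : ℝ), ∃ δ₀ > 0, ∃ t₀ > 0, ∀ δ t : ℝ, 0 < δ → δ < δ₀ → 0 ≤ t → t ≤ t₀ → ∀ {r₁ r₂ : ℝ}, ρ ≤ r₁ →
      ∀ G : TriMarkedDomain 4,
        (∀ x ∈ G.verts, triMeshPoint δ x ∉ R.carrier →
          infDist (triMeshPoint δ x) (R.arc 1) ≤ t ∨ infDist (triMeshPoint δ x) (R.arc 3) ≤ t) →
        (∀ x ∈ G.verts, triMeshPoint δ x ∈ R.carrier → (∀ i, ρ ≤ dist (triMeshPoint δ x) (R.pt i)) →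
          8 * δ < infDist (triMeshPoint δ x) (R.arc 0) ∧ 8 * δ < infDist (triMeshPoint δ x) (R.arc 2)) →
        (∀ u ∈ G.arc 1, (∀ i, ρ ≤ dist (triMeshPoint δ u) (R.pt i)) →
          4 * δ ≤ infDist (triMeshPoint δ u) R.carrier ∧ infDist (triMeshPoint δ u) (R.arc 1) ≤ t) →
        (∀ v ∈ G.arc 3, (∀ i, ρ ≤ dist (triMeshPoint δ v) (R.pt i)) →
          4 * δ ≤ infDist (triMeshPoint δ v) R.carrier ∧ infDist (triMeshPoint δ v) (R.arc 3) ≤ t) →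
        (∀ u ∈ G.arc 1, r₂ < dist (triMeshPoint δ u) (R.pt 3) ∧ r₂ < dist (triMeshPoint δ u) (R.pt 0)) →
        (∀ v ∈ G.arc 3, r₂ < dist (triMeshPoint δ v) (R.pt 1) ∧ r₂ < dist (triMeshPoint δ v) (R.pt 2)) →
        cell δ ≤ G.openCrossingProb 0 2 +
          ∑ i : Fin 4, (triSitePercolation half).real (triAnnulusCrossing false δ (R.pt i) r₁ r₂)) :
    Tendsto cell (𝓝[>] 0) (𝓝 (carlesonRatio a c d)) := by
  classical
  have hR1 : ∀ z ∈ R.carrier, R.index z = 1 := fun z hz => index_eq_one_of_isCarlesonMap R ψ habc hψ hacw hz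
  obtain ⟨Gm, Gp, hGm, hGp, e, he, hsand⟩ := cell_exists_discreteApprox R hR1 cell hsandL hsandU
  -- the discharged discrete facts of Bollobás–Riordan Ch. 7
  have h13 : tri_discreteCauchy :=
    tri_discreteCauchy_of_subset_arms_of_rotate tri_sepEvent_diff_subset_arms_holds tri_sepDiffProb_rotate_holds
  have h198 : tri_sepProb_sub_le_of_dualPath :=
    tri_sepProb_sub_le_of_dualPath_of_subset_arms tri_sepEvent_diff_subset_arms_holds
  have h200 : tri_sepProb_boundary_tendsto := tri_sepProb_boundary_tendsto_holds
  have h40 : tri_openCrossingProb_approx_sepProb := tri_openCrossingProb_approx_sepProb_holds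
  -- separating data of the two discrete approximations
  set Sm : ℝ → Finset ℂ := fun δ => ((Gm δ).faces).image fun w => (δ : ℂ) * hexCenter w with hSm
  set Sp : ℝ → Finset ℂ := fun δ => ((Gp δ).faces).image fun w => (δ : ℂ) * hexCenter w with hSp
  set fm : ℝ → Fin 3 → ℂ → ℝ := fun δ i => (Gm δ).dropLast.sepProbFun δ i with hfm
  set fp : ℝ → Fin 3 → ℂ → ℝ := fun δ i => (Gp δ).dropLast.sepProbFun δ i with hfp
  have hDm : IsSeparatingData R (triangleTurn a b c) Sm fm := by
    rw [hacw]; exact isSeparatingData_of_discreteApprox h13 h198 h200 hGm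
  have hDp : IsSeparatingData R (triangleTurn a b c) Sp fp := by
    rw [hacw]; exact isSeparatingData_of_discreteApprox h13 h198 h200 hGp
  obtain ⟨zsm, hzsm, hztm, hfzm⟩ := h40 R Gm hGm
  obtain ⟨zsp, hzsp, hztp, hfzp⟩ := h40 R Gp hGp
  set zm : ℝ → ℂ := fun δ => (δ : ℂ) * hexCenter (zsm δ) with hzm
  set zp : ℝ → ℂ := fun δ => (δ : ℂ) * hexCenter (zsp δ) with hzp
  -- the families (McShane interpolants)
  obtain ⟨εm, hεm, hdensem⟩ := hDm.dense
  obtain ⟨εp, hεp, hdensep⟩ := hDp.dense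
  set gm : ℝ → Fin 3 → ℂ → ℝ := dataFamily Sm fm εm with hgm
  set gp : ℝ → Fin 3 → ℂ → ℝ := dataFamily Sp fp εp with hgp
  -- eventual facts, packaged on a horizon `(0, δ₀)`
  have hmem : ∀ᶠ δ in 𝓝[>] (0 : ℝ), zm δ ∈ Sm δ ∧ zm δ ∈ R.carrier ∧ zp δ ∈ Sp δ ∧ zp δ ∈ R.carrier := by
    filter_upwards [hzsm, hzsp] with δ hm hp
    exact ⟨Finset.mem_image_of_mem _ hm.1, hm.2, Finset.mem_image_of_mem _ hp.1, hp.2⟩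
  obtain ⟨δ₀, hδ₀, hgood⟩ := exists_forall_Ioo_of_eventually hmem
  have hfam_m : IsSmirnovFamily R a b c δ₀ gm := hDm.isSmirnovFamily hεm hdensem δ₀
  have hfam_p : IsSmirnovFamily R a b c δ₀ gp := hDp.isSmirnovFamily hεp hdensep δ₀
  have hM := triangleIntegral_eq_zero_of_forall_lattice_holds
  have hU := smirnov_claim24_holds
  have h1 : Tendsto (fun δ => gm δ 1 (zm δ)) (𝓝[>] 0) (𝓝 (carlesonRatio a c d)) :=
    hfam_m.tendsto_apply_one hM hU hδ₀ habc hd hψ (fun δ hδ => (hgood δ hδ).2.1) hztm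
  have h2 : Tendsto (fun δ => gp δ 1 (zp δ)) (𝓝[>] 0) (𝓝 (carlesonRatio a c d)) :=
    hfam_p.tendsto_apply_one hM hU hδ₀ habc hd hψ (fun δ hδ => (hgood δ hδ).2.2.2) hztp
  -- the interpolants are close to the separating probabilities at the chosen faces
  have hdiffm : Tendsto (fun δ => gm δ 1 (zm δ) - fm δ 1 (zm δ)) (𝓝[>] 0) (𝓝 0) := by
    rw [Metric.tendsto_nhdsWithin_nhds]
    intro η hη
    obtain ⟨δ₁, hδ₁, h₁⟩ := exists_forall_Ioo_of_eventually ((dataFamily_approx hDm hεm (half_pos hη)).and hmem)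
    refine ⟨δ₁, hδ₁, fun {δ} hδpos hδd => ?_⟩
    have hδ : δ ∈ Ioo 0 δ₁ := by
      refine ⟨hδpos, ?_⟩
      rw [Real.dist_eq, sub_zero, abs_of_pos (mem_Ioi.1 hδpos)] at hδd
      exact hδd
    obtain ⟨happ, hm⟩ := h₁ δ hδ
    have h := happ 1 (zm δ) hm.1
    rw [Real.dist_0_eq_abs, abs_lt]
    constructor <;> simp only [hgm] <;> linarith [h.1, h.2]
  have hdiffp : Tendsto (fun δ => gp δ 1 (zp δ) - fp δ 1 (zp δ)) (𝓝[>] 0) (𝓝 0) := by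
    rw [Metric.tendsto_nhdsWithin_nhds]
    intro η hη
    obtain ⟨δ₁, hδ₁, h₁⟩ := exists_forall_Ioo_of_eventually ((dataFamily_approx hDp hεp (half_pos hη)).and hmem)
    refine ⟨δ₁, hδ₁, fun {δ} hδpos hδd => ?_⟩
    have hδ : δ ∈ Ioo 0 δ₁ := by
      refine ⟨hδpos, ?_⟩
      rw [Real.dist_eq, sub_zero, abs_of_pos (mem_Ioi.1 hδpos)] at hδd
      exact hδd
    obtain ⟨happ, hm⟩ := h₁ δ hδ
    have h := happ 1 (zp δ) hm.2.2.1
    rw [Real.dist_0_eq_abs, abs_lt]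
    constructor <;> simp only [hgp] <;> linarith [h.1, h.2]
  -- the separating probabilities at the chosen faces are close to the crossing probabilities (40)
  have hpos : ∀ᶠ δ in 𝓝[>] (0 : ℝ), δ ≠ 0 := (eventually_mem_nhdsWithin).mono fun δ hδ => ne_of_gt hδ
  have hfm' : Tendsto (fun δ => (Gm δ).openCrossingProb 0 2 - fm δ 1 (zm δ)) (𝓝[>] 0) (𝓝 0) := by
    refine hfzm.congr' ?_
    filter_upwards [hpos] with δ hδ0
    simp only [hfm, hzm]
    rw [(Gm δ).dropLast.sepProbFun_apply hδ0]
  have hfp' : Tendsto (fun δ => (Gp δ).openCrossingProb 0 2 - fp δ 1 (zp δ)) (𝓝[>] 0) (𝓝 0) := by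
    refine hfzp.congr' ?_
    filter_upwards [hpos] with δ hδ0
    simp only [hfp, hzp]
    rw [(Gp δ).dropLast.sepProbFun_apply hδ0]
  -- squeeze: `gm(zm) - E ≤ cell ≤ gp(zp) + E` with `E → 0`
  set E : ℝ → ℝ := fun δ => e δ + |gm δ 1 (zm δ) - fm δ 1 (zm δ)| + |(Gm δ).openCrossingProb 0 2 - fm δ 1 (zm δ)| +
    |gp δ 1 (zp δ) - fp δ 1 (zp δ)| + |(Gp δ).openCrossingProb 0 2 - fp δ 1 (zp δ)| with hE
  have hE0 : Tendsto E (𝓝[>] 0) (𝓝 0) := by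
    have := (((he.add hdiffm.abs).add hfm'.abs).add hdiffp.abs).add hfp'.abs
    simpa using this
  have hlow : Tendsto (fun δ => gm δ 1 (zm δ) - E δ) (𝓝[>] 0) (𝓝 (carlesonRatio a c d)) := by
    simpa using h1.sub hE0
  have hup : Tendsto (fun δ => gp δ 1 (zp δ) + E δ) (𝓝[>] 0) (𝓝 (carlesonRatio a c d)) := by
    simpa using h2.add hE0
  refine tendsto_of_tendsto_of_tendsto_of_le_of_le' hlow hup (hsand.mono fun δ hδ => ?_) (hsand.mono fun δ hδ => ?_)
  · have h3 := le_abs_self (gm δ 1 (zm δ) - fm δ 1 (zm δ))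
    have h4 := le_abs_self ((Gm δ).openCrossingProb 0 2 - fm δ 1 (zm δ))
    have h5 := neg_abs_le ((Gm δ).openCrossingProb 0 2 - fm δ 1 (zm δ))
    have h6 := abs_nonneg (gp δ 1 (zp δ) - fp δ 1 (zp δ))
    have h7 := abs_nonneg ((Gp δ).openCrossingProb 0 2 - fp δ 1 (zp δ))
    simp only [hE]
    linarith [hδ.1]
  · have h3 := neg_abs_le (gp δ 1 (zp δ) - fp δ 1 (zp δ))
    have h4 := le_abs_self ((Gp δ).openCrossingProb 0 2 - fp δ 1 (zp δ))
    have h5 := neg_abs_le ((Gp δ).openCrossingProb 0 2 - fp δ 1 (zp δ))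
    have h6 := abs_nonneg (gm δ 1 (zm δ) - fm δ 1 (zm δ))
    have h7 := abs_nonneg ((Gm δ).openCrossingProb 0 2 - fm δ 1 (zm δ))
    simp only [hE]
    linarith [hδ.2]

end Summit.CriticalPhenomena.CardyFormulaZ2.Theorems.SmirnovCellAnchor

end
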